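import Summits.BirchSwinnertonDyer.Rank1Residual.Additive.X3BranchDegenerateEndStateLayerClasses
import Summits.BirchSwinnertonDyer.Rank1Residual.Additive.X3DegenerateDisplayKitRecord
import HarnessLib

/-!
# X3, the DEGENERATE rows at `p = 3`, rank `0`, OFF the sub-locus: the per-pair DISPLAY KIT with the
# U-side classes over the first layer `ℚ_1` (cell `bsd-eis`, seat `bsd-eis-x3` gen 7; sequel of
# `X3DegenerateDisplayKit.lean` / `X3DegenerateDisplayKitRecord.lean` (gen 6/7) and of
# `X3BranchDegenerateEndStateLayerClasses.lean`; route K1 `AdditiveBranchIMC`, crux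
# `GordTwoRankZeroOffCaseOne` — supports only)

HONEST FRAMING (`run/shared/lean/pub/bsd-eis/README.md` §4): THEOREMS ONLY; nothing is booked; no label,
tier or count of record moves here. The end state
`ClassX3Gord.bsdp_three_rankZero_degenerate_of_facts_of_torsionFact_of_layerClasses` is put in the shape
a per-pair display file feeds with kernel-checked data only — as gen 6's
`ClassX3Gord.bsdp_three_degenerate_display`, with the `k` rational `Σ₀`-units replaced by the LAYER-ONE
unit data (`ι` units `P_i(θ)` of `ℚ(ζ₉)⁺` with conjugates, cube certificates, norms and a cubic-residue
independence certificate):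
* `ClassX3Gord.bsdp_three_degenerate_display_layer` — UNIT rows: 11 PUBLISHED records + ONE Cremona
  datum `hL : L(W,1) = q·Ω_W` (`q ≠ 0`, `ord₃ q = 0`) + kernel data, under `Σδ + 1 ≤ #T + #ι`;
* `ClassX3Gord.bsdp_three_degenerate_display_layer_of_record` — NON-UNIT rows: the same + ONE Q6
  record `hrec : CensusQ6.GordOddFirstUnitIndexAt W 3 n`, under `n + Σδ + 1 ≤ #T + #ι`.
References: [GreenbergVatsal2000] §2 pp. 26–30; [GreenbergLNM1716] §3; [MazurTateTeitelbaum1986Invent]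
§I.10, §I.13; [SilvermanAEC2009] III.2.3; [Washington1997] §13.1.
-/

set_option autoImplicit false

noncomputable section

open scoped Classical AddSubgroup

namespace Summit.BirchSwinnertonDyer.Rank1Residual.Additive

open WeierstrassCurve NumberField IsDedekindDomain Field
  Literature.NumberTheory.EllipticCurves
  Literature.NumberTheory.EllipticCurves.ModularForms
  Literature.NumberTheory.EllipticCurves.GreenbergSelmer
  Literature.NumberTheory.EllipticCurves.GreenbergVatsal2000
  Literature.NumberTheory.EllipticCurves.Rank1Residual
  Literature.NumberTheory.EllipticCurves.Rank1Residual.Typed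
  Literature.NumberTheory.GaloisRepresentations
  Summit.BirchSwinnertonDyer.Rank1Residual.X1.MuLambda
  Summit.BirchSwinnertonDyer.Rank1Residual.AdditivePotMult
  Summit.BirchSwinnertonDyer.Rank1Residual.Additive.X3Branch

namespace X3DegenerateDisplayKit

/-- **`BSD₃(W)` on a DEGENERATE X3♯(G-ord) row of rank `0`, OFF the sub-locus — DISPLAY SHAPE with
layer-one units; covers UNIT rows (`hrec` at index `0` derived from `hL` by the caller via
`CensusQ6.gordOddFirstUnitIndexAt_zero_of_unitLValue`) and NON-UNIT rows (ONE Q6 record `hrec`).**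
Displayed: the 11 PUBLISHED records, ONE Cremona datum `hL : L(W,1) = q·Ω_W` with `q ≠ 0` (for
`r_an = 0`), ONE Q6 record `hrec : CensusQ6.GordOddFirstUnitIndexAt W 3 n`. KERNEL data: the class
predicate; `Σ₀`; the `3`-torsion point `(x₀, y₀)`; the T-side primes `T`; the layer-one U-side data of
`X3Branch.pow_card_le_natCard_residualQuotSelmer_of_trivialLine_layerOne`; `n + Σδ + 1 ≤ #T + #ι`.
[cite: GreenbergVatsal2000, §2 pp. 26–30] [cite: GreenbergLNM1716, §3 p. 86]
[cite: MazurTateTeitelbaum1986Invent, §I.10 (10.1), §I.13] [cite: Washington1997, §13.1] -/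
theorem _root_.Summit.BirchSwinnertonDyer.Rank1Residual.Additive.ClassX3Gord.bsdp_three_degenerate_display_layer_of_record
    [Fact (Nat.Prime 3)] {W : WeierstrassCurve ℚ} [W.IsElliptic] [W.IsGloballyMinimal]
    (hTors : Greenberg1999.finite_torsion_cyclotomicZpExtension)
    (hDelG : Delbourgo1998.prop4_rankZero_constantCoeff_eq_unit_mul_of_potGoodOrd)
    (hDel98 : Delbourgo1998.prop4_rankZero_pow_dvd_constantCoeff)
    (hGZK : rank_eq_analyticRank_of_analyticRank_le_one) (hmod : hasEntireLFunction_rat)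
    (hmodD : nonempty_modularParametrizationData)
    (hW16 : Wuthrich2014.thm16_halfEigenCharIdeal_dvd_cyclotomicPrime)
    (h23 : datumSelmer_nonPrimitive_invariants)
    (hRQ : datumSelmer_divisible_of_finite_torsionBy_of_gr_inertiaInvariants_eq_zero)
    (hGrK : Greenberg1999.imKummer_ge_strictCondition_goodOrdinary)
    (hLiftE : residualEpsilon_surjOn_of_lineEven)
    (hX : ClassX3Gord W 3) {qL : ℚ} (hL : W.entireLFunction 1 = (qL : ℂ) * (W.realPeriodRat : ℂ))
    (hq0 : qL ≠ 0) {n : ℕ} (hrec : CensusQ6.GordOddFirstUnitIndexAt W 3 n)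
    (S₀ : Finset (HeightOneSpectrum (𝓞 ℚ))) (hne : S₀.Nonempty)
    (hS₀ : ∀ v ∈ S₀, ((3 : ℕ) : 𝓞 ℚ) ∉ v.asIdeal)
    (hS : ∀ v : HeightOneSpectrum (𝓞 ℚ), v ∉ S₀ → ((3 : ℕ) : 𝓞 ℚ) ∉ v.asIdeal →
      W.HasGoodReductionAt v)
    {x₀ y₀ : ℚ} (heq : y₀ ^ 2 + W.a₁ * x₀ * y₀ + W.a₃ * y₀ = x₀ ^ 3 + W.a₂ * x₀ ^ 2 + W.a₄ * x₀ + W.a₆)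
    (hψ : W.Ψ₃.eval x₀ = 0) (hd : W.Ψ₂Sq.eval x₀ ≠ 0)
    (T : Finset ℕ) (hT : ∀ ℓ ∈ T, ℓ.Prime ∧ 3 ∣ ℓ - 1 ∧ ∃ v ∈ S₀, ((ℓ : ℕ) : 𝓞 ℚ) ∈ v.asIdeal)
    {ζ : AlgebraicClosure ℚ} (hζ : IsPrimitiveRoot ζ 9)
    {k : ℕ} (P : Fin k → Fin 3 → Fin 3 → ℤ)
    (hconj1 : ∀ i, (P i 0 0 : AlgebraicClosure ℚ) + P i 0 1 * ((ζ + ζ ^ 8) ^ 2 - 2) +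
      P i 0 2 * ((ζ + ζ ^ 8) ^ 2 - 2) ^ 2 =
      (P i 1 0 : AlgebraicClosure ℚ) + P i 1 1 * (ζ + ζ ^ 8) + P i 1 2 * (ζ + ζ ^ 8) ^ 2)
    (hconj2 : ∀ i, (P i 0 0 : AlgebraicClosure ℚ) + P i 0 1 * (-(ζ + ζ ^ 8) ^ 2 - (ζ + ζ ^ 8) + 2) +
      P i 0 2 * (-(ζ + ζ ^ 8) ^ 2 - (ζ + ζ ^ 8) + 2) ^ 2 =
      (P i 2 0 : AlgebraicClosure ℚ) + P i 2 1 * (ζ + ζ ^ 8) + P i 2 2 * (ζ + ζ ^ 8) ^ 2)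
    (D Tc : Fin k → Fin 3 → Fin 3 → ℤ)
    (hcube : ∀ i j, ((P i j 0 : AlgebraicClosure ℚ) + P i j 1 * (ζ + ζ ^ 8) + P i j 2 * (ζ + ζ ^ 8) ^ 2) *
      ((D i j 0 : AlgebraicClosure ℚ) + D i j 1 * (ζ + ζ ^ 8) + D i j 2 * (ζ + ζ ^ 8) ^ 2) ^ 3 =
      1 + 9 * ((Tc i j 0 : AlgebraicClosure ℚ) + Tc i j 1 * (ζ + ζ ^ 8) + Tc i j 2 * (ζ + ζ ^ 8) ^ 2))
    (nm : Fin k → ℕ) (hn0 : ∀ i, nm i ≠ 0)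
    (hnorm : ∀ i, ((P i 0 0 : AlgebraicClosure ℚ) + P i 0 1 * (ζ + ζ ^ 8) + P i 0 2 * (ζ + ζ ^ 8) ^ 2) *
      (((P i 1 0 : AlgebraicClosure ℚ) + P i 1 1 * (ζ + ζ ^ 8) + P i 1 2 * (ζ + ζ ^ 8) ^ 2) *
        ((P i 2 0 : AlgebraicClosure ℚ) + P i 2 1 * (ζ + ζ ^ 8) + P i 2 2 * (ζ + ζ ^ 8) ^ 2)) = nm i)
    (hnS : ∀ i (v : HeightOneSpectrum (𝓞 ℚ)), ((nm i : ℕ) : 𝓞 ℚ) ∈ v.asIdeal → v ∈ S₀)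
    {R : ℕ} (q : Fin R → ℕ) (hq : ∀ ρ, (q ρ).Prime) (hq1 : ∀ ρ, 3 ∣ q ρ - 1)
    (r : (ρ : Fin R) → Fin 3 → ZMod (q ρ)) (hrr : ∀ ρ kk, r ρ kk ^ 3 - 3 * r ρ kk + 1 = 0)
    (w : (ρ : Fin R) → Fin 3 → Fin 3 → ZMod (q ρ))
    (hw : ∀ ρ (c c' : Fin 3), ∑ kk, w ρ c kk * r ρ kk ^ c'.val = if c = c' then 1 else 0)
    (ω : (ρ : Fin R) → ZMod (q ρ)) (hω : ∀ ρ, ω ρ ^ 3 = 1 ∧ ω ρ ≠ 1)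
    (e : Fin R → Fin k → ℕ)
    (he : ∀ ρ i, ((P i 0 0 : ZMod (q ρ)) + (P i 0 1 : ZMod (q ρ)) * r ρ 0 +
      (P i 0 2 : ZMod (q ρ)) * r ρ 0 ^ 2) ^ ((q ρ - 1) / 3) = ω ρ ^ e ρ i)
    (hnz : ∀ ρ i, (P i 0 0 : ZMod (q ρ)) + (P i 0 1 : ZMod (q ρ)) * r ρ 0 +
      (P i 0 2 : ZMod (q ρ)) * r ρ 0 ^ 2 ≠ 0)
    (Linv : Fin k → Fin R → ℤ)
    (hLinv : ∀ i i', (∑ ρ, (Linv i ρ : ZMod 3) * (e ρ i' : ZMod 3)) = if i = i' then 1 else 0)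
    (hcount : n + ∑ v ∈ S₀, delta W 3 v + 1 ≤ T.card + k) :
    BSDp W 3 := by
  -- `r_an = 0` from the non-vanishing `L`-value
  have hr : W.analyticRank = 0 := by
    refine (analyticRank_eq_zero_iff_holds (hmod _)).mpr ?_
    rw [hL]
    exact mul_ne_zero (by exact_mod_cast hq0) (by exact_mod_cast (realPeriodRat_pos_holds (W := W)).ne')
  -- the trivial rational line of the `3`-torsion point
  obtain ⟨Φ₀, hΦ, htriv⟩ := exists_trivialLine_of_ratPoint heq hψ hd
  refine ClassX3Gord.bsdp_three_rankZero_degenerate_of_facts_of_torsionFact_of_layerClasses hTors hDelG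
    hDel98 hGZK hmod hmodD hW16 h23 hRQ hGrK hLiftE hX hr S₀ hne hS₀ hS Φ₀ hΦ htriv
    (ClassX3Gord.unitCoeffCert_three_of_gordOddFirstUnitIndex hX hrec) T hT hζ P hconj1 hconj2 D Tc hcube
    nm hn0 hnorm hnS q hq hq1 r hrr w hw ω hω e he hnz Linv hLinv ?_
  rwa [Fintype.card_fin]

/-- **UNIT rows** (`ord₃ q = 0`): the Q6 record at index `0` follows from the unit `L`-value
(`CensusQ6.gordOddFirstUnitIndexAt_zero_of_unitLValue`), so the display carries the 11 PUBLISHED records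
+ ONE Cremona datum `hL` only, under `Σδ + 1 ≤ #T + #ι`.
[cite: MazurTateTeitelbaum1986Invent, §I.10 (10.1), §I.13] [cite: GreenbergVatsal2000, §2 pp. 26–30] -/
theorem _root_.Summit.BirchSwinnertonDyer.Rank1Residual.Additive.ClassX3Gord.bsdp_three_degenerate_display_layer
    [Fact (Nat.Prime 3)] {W : WeierstrassCurve ℚ} [W.IsElliptic] [W.IsGloballyMinimal]
    (hTors : Greenberg1999.finite_torsion_cyclotomicZpExtension)
    (hDelG : Delbourgo1998.prop4_rankZero_constantCoeff_eq_unit_mul_of_potGoodOrd)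
    (hDel98 : Delbourgo1998.prop4_rankZero_pow_dvd_constantCoeff)
    (hGZK : rank_eq_analyticRank_of_analyticRank_le_one) (hmod : hasEntireLFunction_rat)
    (hmodD : nonempty_modularParametrizationData)
    (hW16 : Wuthrich2014.thm16_halfEigenCharIdeal_dvd_cyclotomicPrime)
    (h23 : datumSelmer_nonPrimitive_invariants)
    (hRQ : datumSelmer_divisible_of_finite_torsionBy_of_gr_inertiaInvariants_eq_zero)
    (hGrK : Greenberg1999.imKummer_ge_strictCondition_goodOrdinary)
    (hLiftE : residualEpsilon_surjOn_of_lineEven)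
    (hX : ClassX3Gord W 3) {qL : ℚ} (hL : W.entireLFunction 1 = (qL : ℂ) * (W.realPeriodRat : ℂ))
    (hq0 : qL ≠ 0) (hv : padicValRat 3 qL = 0)
    (S₀ : Finset (HeightOneSpectrum (𝓞 ℚ))) (hne : S₀.Nonempty)
    (hS₀ : ∀ v ∈ S₀, ((3 : ℕ) : 𝓞 ℚ) ∉ v.asIdeal)
    (hS : ∀ v : HeightOneSpectrum (𝓞 ℚ), v ∉ S₀ → ((3 : ℕ) : 𝓞 ℚ) ∉ v.asIdeal →
      W.HasGoodReductionAt v)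
    {x₀ y₀ : ℚ} (heq : y₀ ^ 2 + W.a₁ * x₀ * y₀ + W.a₃ * y₀ = x₀ ^ 3 + W.a₂ * x₀ ^ 2 + W.a₄ * x₀ + W.a₆)
    (hψ : W.Ψ₃.eval x₀ = 0) (hd : W.Ψ₂Sq.eval x₀ ≠ 0)
    (T : Finset ℕ) (hT : ∀ ℓ ∈ T, ℓ.Prime ∧ 3 ∣ ℓ - 1 ∧ ∃ v ∈ S₀, ((ℓ : ℕ) : 𝓞 ℚ) ∈ v.asIdeal)
    {ζ : AlgebraicClosure ℚ} (hζ : IsPrimitiveRoot ζ 9)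
    {k : ℕ} (P : Fin k → Fin 3 → Fin 3 → ℤ)
    (hconj1 : ∀ i, (P i 0 0 : AlgebraicClosure ℚ) + P i 0 1 * ((ζ + ζ ^ 8) ^ 2 - 2) +
      P i 0 2 * ((ζ + ζ ^ 8) ^ 2 - 2) ^ 2 =
      (P i 1 0 : AlgebraicClosure ℚ) + P i 1 1 * (ζ + ζ ^ 8) + P i 1 2 * (ζ + ζ ^ 8) ^ 2)
    (hconj2 : ∀ i, (P i 0 0 : AlgebraicClosure ℚ) + P i 0 1 * (-(ζ + ζ ^ 8) ^ 2 - (ζ + ζ ^ 8) + 2) +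
      P i 0 2 * (-(ζ + ζ ^ 8) ^ 2 - (ζ + ζ ^ 8) + 2) ^ 2 =
      (P i 2 0 : AlgebraicClosure ℚ) + P i 2 1 * (ζ + ζ ^ 8) + P i 2 2 * (ζ + ζ ^ 8) ^ 2)
    (D Tc : Fin k → Fin 3 → Fin 3 → ℤ)
    (hcube : ∀ i j, ((P i j 0 : AlgebraicClosure ℚ) + P i j 1 * (ζ + ζ ^ 8) + P i j 2 * (ζ + ζ ^ 8) ^ 2) *
      ((D i j 0 : AlgebraicClosure ℚ) + D i j 1 * (ζ + ζ ^ 8) + D i j 2 * (ζ + ζ ^ 8) ^ 2) ^ 3 =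
      1 + 9 * ((Tc i j 0 : AlgebraicClosure ℚ) + Tc i j 1 * (ζ + ζ ^ 8) + Tc i j 2 * (ζ + ζ ^ 8) ^ 2))
    (nm : Fin k → ℕ) (hn0 : ∀ i, nm i ≠ 0)
    (hnorm : ∀ i, ((P i 0 0 : AlgebraicClosure ℚ) + P i 0 1 * (ζ + ζ ^ 8) + P i 0 2 * (ζ + ζ ^ 8) ^ 2) *
      (((P i 1 0 : AlgebraicClosure ℚ) + P i 1 1 * (ζ + ζ ^ 8) + P i 1 2 * (ζ + ζ ^ 8) ^ 2) *
        ((P i 2 0 : AlgebraicClosure ℚ) + P i 2 1 * (ζ + ζ ^ 8) + P i 2 2 * (ζ + ζ ^ 8) ^ 2)) = nm i)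
    (hnS : ∀ i (v : HeightOneSpectrum (𝓞 ℚ)), ((nm i : ℕ) : 𝓞 ℚ) ∈ v.asIdeal → v ∈ S₀)
    {R : ℕ} (q : Fin R → ℕ) (hq : ∀ ρ, (q ρ).Prime) (hq1 : ∀ ρ, 3 ∣ q ρ - 1)
    (r : (ρ : Fin R) → Fin 3 → ZMod (q ρ)) (hrr : ∀ ρ kk, r ρ kk ^ 3 - 3 * r ρ kk + 1 = 0)
    (w : (ρ : Fin R) → Fin 3 → Fin 3 → ZMod (q ρ))
    (hw : ∀ ρ (c c' : Fin 3), ∑ kk, w ρ c kk * r ρ kk ^ c'.val = if c = c' then 1 else 0)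
    (ω : (ρ : Fin R) → ZMod (q ρ)) (hω : ∀ ρ, ω ρ ^ 3 = 1 ∧ ω ρ ≠ 1)
    (e : Fin R → Fin k → ℕ)
    (he : ∀ ρ i, ((P i 0 0 : ZMod (q ρ)) + (P i 0 1 : ZMod (q ρ)) * r ρ 0 +
      (P i 0 2 : ZMod (q ρ)) * r ρ 0 ^ 2) ^ ((q ρ - 1) / 3) = ω ρ ^ e ρ i)
    (hnz : ∀ ρ i, (P i 0 0 : ZMod (q ρ)) + (P i 0 1 : ZMod (q ρ)) * r ρ 0 +
      (P i 0 2 : ZMod (q ρ)) * r ρ 0 ^ 2 ≠ 0)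
    (Linv : Fin k → Fin R → ℤ)
    (hLinv : ∀ i i', (∑ ρ, (Linv i ρ : ZMod 3) * (e ρ i' : ZMod 3)) = if i = i' then 1 else 0)
    (hcount : ∑ v ∈ S₀, delta W 3 v + 1 ≤ T.card + k) :
    BSDp W 3 :=
  ClassX3Gord.bsdp_three_degenerate_display_layer_of_record hTors hDelG hDel98 hGZK hmod hmodD hW16 h23 hRQ
    hGrK hLiftE hX hL hq0 (CensusQ6.gordOddFirstUnitIndexAt_zero_of_unitLValue hmod (by decide) hX.addv hL hq0 hv)
    S₀ hne hS₀ hS heq hψ hd T hT hζ P hconj1 hconj2 D Tc hcube nm hn0 hnorm hnS q hq hq1 r hrr w hw ω hω e he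
    hnz Linv hLinv (by rwa [zero_add])

end X3DegenerateDisplayKit

end Summit.BirchSwinnertonDyer.Rank1Residual.Additive

end
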